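import Summits.QuantumFields.BalabanUV.T4Continuum.Support.RegionStarLineGaugeRegion
import Summits.QuantumFields.BalabanUV.T4Continuum.Support.ScalarBlockPoincareLocal

/-!
# `BalabanUV.T4Continuum.Support.RegionStarLineGaugeBound` — NE2 (node U1a) formalisation swarm, SUPPLIER item «Δ1-COERC-ORTH-LINE» under
# the owner's sub-row `T4-U1a.S-NE2-D1-DIRICHLET°` (vector layer, W1): SUM BOOKKEEPING FOR THE LINE GAUGE ON AN `e`-THIN BLOCK SET — the
# line-counting lemma, «the line mismatch is two consecutive Bałaban line sums» (exact), and the per-block bound on the mismatch by one line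
# of curls per transverse direction plus the two Bałaban averages (unit b2b-balaban-t4-ne2-formalise-leaf-09, gen 9, v1)

HONEST FRAMING (T4-DAG p. 1).  [folklore] `U = 1` lattice calculus, ONE region of the restricted class `IsEThin e S` (single blocks, `e`-slabs of
thickness one, rods, `e`-thin cylinders …), ONE averaging scale, finite torus, `1 ≤ n`; bookkeeping towards the orbit inequality of
`RegionGaugeOrbit` for that class (sequel `RegionStarLineGaugeEnd`); W1 for general block unions NOT claimed (re-entrant `(e,ν)`-corners break the
anchors; `e`-stacked blocks need the coarse scale); nothing printed is a hypothesis; NE2 (U1a) NOT proved; spine PROVED 0/9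
unchanged; NOT [B9] (3.23)–(3.27) as printed; NOT infinite volume, NOT the mass gap, NOT Clay.  HONEST DEPENDENCY (verbatim): «continuum YM on T⁴ ⇐
BetaPertH ∧ nine spine estimates (0/9 proved); BetaPertH ⇐ (D1) ∧ (D4) ∧ CAP+tail; G-an2-4 gates asym, D1 and NE2/3/4.»

WHAT THIS FILE PROVES (0 sorry), from the pointwise bounds of `RegionStarLineGaugeRegion` (`‖res (x,e)‖² ≤ (1_Ω(x)‖ℓ(x)‖² + 1_Ω(x+e)‖ℓ(x+e)‖²)
/(n+1)²`, `‖res (x,ν)‖² ≤ (4/n)(1_Ω(x) + 1_Ω(x+e_ν))·lineCurl ν x`):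
 * §1 SUM BOOKKEEPING: the region sum in the digit chart (`sum_region_eq`), line-constant fibring (`sum_update_const`), and THE LINE-COUNTING
   LEMMA **`sum_region_lineFun_le`**: `Σ_{x ∈ Ω} Σ_{s ≤ n} g(xstart x + s·e) ≤ 2n·Σ_z g(z)` for `g ≥ 0` (each plaquette of an extended line is
   charged by the `n` sites of ONE block-line of `Ω`: `n` in-block positions + the start position in the `e`-predecessor block).
 * §2 THE MISMATCH IS SEEN BY BAŁABAN's AVERAGES, EXACTLY: **`ell_bpt_eq`** `ℓ(n·y + j) = lineSum Z (n·(y−e) + j) e + lineSum Z (n·y + j) e` for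
   `y ∈ S` (the two consecutive length-`n` line sums of [B5] (1.18) concatenate to the `n + 1` star bonds plus exterior zeros), hence
   **`QsOp_ell`** `(Q′ℓ)(y) = n·((QZ)(y − e, e) + (QZ)(y, e))`; with the in-block Poincaré inequality `ScalarBlockPoincareLocal.sum_block_norm_sub_mean_sq_le`
   (leaf-01-g4) and `ell_add_unitVec_ne` (the mismatch is transversally Lipschitz by one line of curls; constant along the line):
   **`sum_block_ell_sq_le`** `Σ_j ‖ℓ(n·y+j)‖² ≤ (n+1)·Σ_{ν≠e} Σ_j lineCurl ν (n·y+j) + 4n^{d+2}(‖(QZ)(y−e,e)‖² + ‖(QZ)(y,e)‖²)`.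
 The sums over the torus and the END `nsq (A − ∂_Ω(lineGauge A)) ≤ 40·nsq (curlR A) + 16·n^d·nsq (avgR A)` are assembled from these in the
 sequel `RegionStarLineGaugeEnd`.

ABSOLUTE RULE (cell, verbatim): «No internally-minted statement may enter as a cited fact. Every hypothesis is either kernel-proved in
this package or a verbatim quotation of a PUBLISHED theorem with page reference. The manuscript(s) under audit are NOT citable for
their own disputed steps — they are the thing under adjudication; programme-internal (2001/route/tribunal) claims are never citable.»
[folklore] throughout; no def, no `def … : Prop`.  NOT CLAIMED: W1 beyond `e`-thin sets; NE2; NE3; «not in print; our estimate».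
-/

noncomputable section

open scoped BigOperators ComplexConjugate Matrix
open Finset

namespace Summit.QuantumFields.BalabanUV.T4Continuum.RegionStarLineGaugeBound

open Literature.MathematicalPhysics.QuantumFieldTheory.Balaban1983to89.B5Prop11Plancherel (Tor fine unitVec)
open Literature.MathematicalPhysics.QuantumFieldTheory.Balaban1983to89.B5Prop11Lower (nsq nsq_nonneg)
open Literature.MathematicalPhysics.QuantumFieldTheory.Balaban1983to89.B5Action121 (Fs sdiff sdiff_mulVec CurlOp CurlOp_mulVec)
open Literature.MathematicalPhysics.QuantumFieldTheory.Balaban1983to89.B5Block118 (bpt tstep tstep_zero tstep_succ bpt_add_tstep lineSum QsOp QvOp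
  QsOp_mulVec QvOp_mulVec)
open Literature.MathematicalPhysics.QuantumFieldTheory.Balaban1983to89.B5Blocks16 (blockOf blockOf_bpt)
open Summit.QuantumFields.BalabanUV.T4Continuum
open Summit.QuantumFields.BalabanUV.T4Continuum.SubtypeCompression (ext ext_apply_of ext_apply_of_not nsq_ext)
open Summit.QuantumFields.BalabanUV.T4Continuum.ScalarBlockPoincare (nsq_smul)
open Summit.QuantumFields.BalabanUV.T4Continuum.ScalarBlockPoincareLocal (sum_block_norm_sub_mean_sq_le)
open Summit.QuantumFields.BalabanUV.T4Continuum.ScalarBlockTrialFunction (bpt_add_unitVec_of_lt)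
open Summit.QuantumFields.BalabanUV.T4Continuum.RegionGaugeFixedVector (starReg curlR gradR avgR)
open Summit.QuantumFields.BalabanUV.T4Continuum.RegionGaugeFixedVectorFlat (submatrix_mulVec_eq avgR_mulVec)
open Summit.QuantumFields.BalabanUV.T4Continuum.RegionStarLineGauge
open Summit.QuantumFields.BalabanUV.T4Continuum.RegionStarLineGaugeRegion
open Summit.QuantumFields.BalabanUV.Beta.GAN24.DirichletBoxTrace (blockReg sum_eq_sum_bpt sum_update_layers' bpt_update_add_tstep bpt_eq_update_add)

variable {d : ℕ} (n : ℕ) [NeZero n] (M : Fin d → ℕ) [hM : ∀ μ, NeZero (M μ)] (e : Fin d) (S : Tor M → Prop) [DecidablePred S]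

/-! ## §1 Sum bookkeeping: the chart, line-constant fibring, the line-counting lemma -/

/-- the region sum in the digit chart: `Σ_x 1_Ω(x) f(x) = Σ_y 1_S(y) Σ_j f(n·y + j)`. [folklore] -/
theorem sum_region_eq (f : Tor (fine n M) → ℝ) :
    ∑ x, (if blockReg n M S x then f x else 0) = ∑ y : Tor M, if S y then ∑ j : Fin d → Fin n, f (bpt n M y j) else 0 := by
  rw [sum_eq_sum_bpt n M]
  refine sum_congr rfl fun y _ => ?_
  by_cases hy : S y
  · rw [if_pos hy]
    refine sum_congr rfl fun j _ => ?_
    rw [if_pos (show blockReg n M S (bpt n M y j) from by show S (blockOf n M (bpt n M y j)); rw [blockOf_bpt]; exact hy)]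
  · rw [if_neg hy]
    exact sum_eq_zero fun j _ =>
      if_neg (show ¬ blockReg n M S (bpt n M y j) from by show ¬ S (blockOf n M (bpt n M y j)); rw [blockOf_bpt]; exact hy)

omit hM in
/-- fibring a digit sum whose summand does not depend on the `e`-digit: `Σ_j G j = n·Σ_{j : j_e = 0} G j`. [folklore] -/
theorem sum_update_const {G : (Fin d → Fin n) → ℝ} (hG : ∀ j (t : Fin n), G (Function.update j e t) = G j) :
    ∑ j : Fin d → Fin n, G j = n * ∑ j ∈ univ.filter (fun j : Fin d → Fin n => (j e : ℕ) = 0), G j := by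
  rw [sum_update_layers' n e G]
  simp_rw [hG]
  rw [sum_const, card_univ, Fintype.card_fin, nsmul_eq_mul]

omit hM in
/-- one `e`-layer is dominated by the whole digit cube (nonnegative summand): `Σ_{j : j_e = 0} g(j[e ↦ t]) ≤ Σ_j g j`. [folklore] -/
theorem sum_layer_le {g : (Fin d → Fin n) → ℝ} (hg : ∀ j, 0 ≤ g j) (t : Fin n) :
    ∑ j ∈ univ.filter (fun j : Fin d → Fin n => (j e : ℕ) = 0), g (Function.update j e t) ≤ ∑ j : Fin d → Fin n, g j := by
  rw [sum_update_layers' n e g]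
  exact single_le_sum (f := fun s => ∑ j ∈ univ.filter (fun j : Fin d → Fin n => (j e : ℕ) = 0), g (Function.update j e s))
    (fun s _ => sum_nonneg fun j _ => hg _) (mem_univ t)

/-- the in-block positions of all lines of a block cover the block `n` times: `Σ_j Σ_{s<n} g(xstart (n·y+j) + (s+1)·e) = n·Σ_j g(n·y+j)`. [folklore] -/
theorem sum_block_positions (g : Tor (fine n M) → ℝ) (y : Tor M) :
    ∑ j : Fin d → Fin n, ∑ s ∈ range n, g (xstart n M e (bpt n M y j) + tstep (fine n M) e (s + 1)) = n * ∑ j : Fin d → Fin n, g (bpt n M y j) := by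
  have h1 : ∀ j : Fin d → Fin n, ∑ s ∈ range n, g (xstart n M e (bpt n M y j) + tstep (fine n M) e (s + 1))
      = ∑ s : Fin n, g (bpt n M y (Function.update j e s)) := by
    intro j
    rw [← Fin.sum_univ_eq_sum_range (fun s => g (xstart n M e (bpt n M y j) + tstep (fine n M) e (s + 1))) n]
    exact sum_congr rfl fun s _ => by rw [xstart_bpt_add_tstep_succ n M e y j s.isLt]
  simp_rw [h1]
  rw [sum_update_const n e (G := fun j => ∑ s : Fin n, g (bpt n M y (Function.update j e s)))
    (fun j t => by simp_rw [Function.update_idem])]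
  congr 1
  rw [sum_update_layers' n e (fun j => g (bpt n M y j)), sum_comm]

/-- the start positions: `Σ_j g(xstart (n·y+j)) ≤ n·Σ_j g(n·(y−e)+j)` for `g ≥ 0`. [folklore] -/
theorem sum_block_starts_le {g : Tor (fine n M) → ℝ} (hg : ∀ z, 0 ≤ g z) (y : Tor M) :
    ∑ j : Fin d → Fin n, g (xstart n M e (bpt n M y j)) ≤ n * ∑ j : Fin d → Fin n, g (bpt n M (y - unitVec M e) j) := by
  have hn : (0 : ℝ) ≤ n := Nat.cast_nonneg n
  simp_rw [xstart_bpt]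
  rw [sum_update_const n e (G := fun j => g (bpt n M (y - unitVec M e) (Function.update j e (lastD n))))
    (fun j t => by simp_rw [Function.update_idem])]
  exact mul_le_mul_of_nonneg_left (sum_layer_le n e (fun j => hg _) (lastD n)) hn

/-- **THE LINE-COUNTING LEMMA**: `Σ_{x ∈ Ω} Σ_{s ≤ n} g(xstart x + s·e) ≤ 2n·Σ_z g(z)` for `g ≥ 0` (any block set). [folklore] -/
theorem sum_region_lineFun_le {g : Tor (fine n M) → ℝ} (hg : ∀ z, 0 ≤ g z) :
    ∑ x, (if blockReg n M S x then ∑ s ∈ range (n + 1), g (xstart n M e x + tstep (fine n M) e s) else 0) ≤ 2 * n * ∑ z, g z := by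
  have hn : (0 : ℝ) ≤ n := Nat.cast_nonneg n
  rw [sum_region_eq n M S]
  have hsplit : ∀ y : Tor M, ∑ j : Fin d → Fin n, ∑ s ∈ range (n + 1), g (xstart n M e (bpt n M y j) + tstep (fine n M) e s)
      = n * ∑ j : Fin d → Fin n, g (bpt n M y j) + ∑ j : Fin d → Fin n, g (xstart n M e (bpt n M y j)) := by
    intro y
    simp_rw [sum_range_succ' _ n, tstep_zero, add_zero]
    rw [sum_add_distrib, sum_block_positions]
  have hA : ∑ y : Tor M, (n : ℝ) * ∑ j : Fin d → Fin n, g (bpt n M y j) = n * ∑ z, g z := by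
    rw [← mul_sum, ← sum_eq_sum_bpt n M]
  have hB : ∑ y : Tor M, ∑ j : Fin d → Fin n, g (xstart n M e (bpt n M y j)) ≤ n * ∑ z, g z := by
    calc ∑ y : Tor M, ∑ j : Fin d → Fin n, g (xstart n M e (bpt n M y j))
        ≤ ∑ y : Tor M, (n : ℝ) * ∑ j : Fin d → Fin n, g (bpt n M (y - unitVec M e) j) := sum_le_sum fun y _ => sum_block_starts_le n M e hg y
      _ = n * ∑ y : Tor M, ∑ j : Fin d → Fin n, g (bpt n M (y - unitVec M e) j) := by rw [mul_sum]
      _ = n * ∑ z, g z := by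
          rw [sum_eq_sum_bpt n M g]
          congr 1
          exact (Equiv.subRight (unitVec M e)).sum_comp (fun y => ∑ j : Fin d → Fin n, g (bpt n M y j))
  calc ∑ y : Tor M, (if S y then ∑ j : Fin d → Fin n, ∑ s ∈ range (n + 1), g (xstart n M e (bpt n M y j) + tstep (fine n M) e s) else 0)
      ≤ ∑ y : Tor M, ∑ j : Fin d → Fin n, ∑ s ∈ range (n + 1), g (xstart n M e (bpt n M y j) + tstep (fine n M) e s) := by
        refine sum_le_sum fun y _ => ?_
        split_ifs
        · exact le_rfl
        · exact sum_nonneg fun j _ => sum_nonneg fun s _ => hg _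
    _ = ∑ y : Tor M, ((n : ℝ) * ∑ j : Fin d → Fin n, g (bpt n M y j) + ∑ j : Fin d → Fin n, g (xstart n M e (bpt n M y j))) :=
        sum_congr rfl fun y _ => hsplit y
    _ ≤ n * ∑ z, g z + n * ∑ z, g z := by rw [sum_add_distrib, hA]; exact add_le_add le_rfl hB
    _ = 2 * n * ∑ z, g z := by ring

/-! ## §2 The mismatch is seen by Bałaban's averages; the per-block bound -/

variable {S}
variable (A : {b // starReg n M S b} → ℂ)

/-- **THE MISMATCH IS TWO CONSECUTIVE BAŁABAN LINE SUMS**: for `y ∈ S`,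
`ℓ(n·y + j) = lineSum (ext A) (n·(y − e) + j) e + lineSum (ext A) (n·y + j) e` ([B5] (1.18)'s «A([x, x(b)])» from the corresponding site of the
preceding block and from the site itself cover exactly the `n + 1` star `e`-bonds of the line, plus bonds inside the exterior blocks `y ± e`).
[cite: Balaban1984PropagatorsI, (1.18) p.20 (shape)] [folklore] -/
theorem ell_bpt_eq (h : IsEThin M e S) {y : Tor M} (hy : S y) (j : Fin d → Fin n) :
    ell n M e (ext (starReg n M S) A) (bpt n M y j)
      = lineSum n M (ext (starReg n M S) A) (bpt n M (y - unitVec M e) j) e + lineSum n M (ext (starReg n M S) A) (bpt n M y j) e := by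
  set Z := ext (starReg n M S) A with hZ
  set x := bpt n M y j with hx
  set w := xstart n M e x with hw
  set t : ℕ := (j e : ℕ) with ht
  have htn : t < n := (j e).isLt
  obtain ⟨a, ha⟩ : ∃ a, n = t + 1 + a := ⟨n - (t + 1), by omega⟩
  have hxt : edig n M e x = t := edig_bpt n M e y j
  let f : ℕ → ℂ := fun s => Z (w + tstep (fine n M) e s, e)
  -- (1) the line sum from `x` = positions `t+1 … n` (genuine) and `n+1 … n+t` (inside block `y + e`: zero)
  have h1 : lineSum n M Z x e = ∑ u ∈ range (a + 1), f (t + 1 + u) := by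
    rw [lineSum, Fin.sum_univ_eq_sum_range (fun u => Z (x + tstep (fine n M) e u, e)) n]
    have hre : ∀ u, x + tstep (fine n M) e u = w + tstep (fine n M) e (t + 1 + u) := fun u => by
      rw [hw, ← hxt, tstep_add, ← add_assoc, xstart_add]
    simp_rw [hre]
    rw [show range n = range ((a + 1) + t) by congr 1; omega, sum_range_add]
    have hzero : ∑ v ∈ range t, f (t + 1 + (a + 1 + v)) = 0 := by
      refine sum_eq_zero fun v hv => ?_
      have hv' : v < t := mem_range.mp hv
      have hvn : v < n := by omega
      have hv1 : v + 1 < n := by omega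
      -- the bond `(w + (n+1+v)·e, e)` lies inside block `y + e`
      have hsite : w + tstep (fine n M) e (t + 1 + (a + 1 + v)) = bpt n M (y + unitVec M e) (Function.update j e ⟨v, hvn⟩) := by
        rw [show t + 1 + (a + 1 + v) = (n + 1) + v by omega, tstep_add, ← add_assoc, hw, hx, xstart_bpt_add_tstep_end]
        exact bpt_update_add_tstep n M _ j e ⟨v, hvn⟩
      have hS1 : ¬ S (y + unitVec M e) := h.noStack _ hy
      refine extA_eq_zero n M S A ?_ ?_
      · show ¬ S (blockOf n M _); rwa [hsite, blockOf_bpt]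
      · show ¬ S (blockOf n M _)
        rwa [hsite, bpt_add_unitVec_of_lt n M _ _ e (by rw [Function.update_self]; exact hv1), blockOf_bpt]
    rw [hzero, add_zero]
  -- (2) the line sum from the preceding block = positions `t−n+1 … −1` (inside block `y − e`: zero) and `0 … t` (genuine)
  have h2 : lineSum n M Z (bpt n M (y - unitVec M e) j) e = ∑ s ∈ range (t + 1), f s := by
    rw [lineSum, Fin.sum_univ_eq_sum_range (fun u => Z (bpt n M (y - unitVec M e) j + tstep (fine n M) e u, e)) n]
    have hb0 : bpt n M (y - unitVec M e) j = bpt n M (y - unitVec M e) (Function.update j e 0) + tstep (fine n M) e t :=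
      bpt_eq_update_add n M _ j e
    have hw' : w = bpt n M (y - unitVec M e) (Function.update j e 0) + tstep (fine n M) e (n - 1) := by
      rw [hw, hx, xstart_bpt, ← bpt_update_add_tstep n M (y - unitVec M e) j e (lastD n)]; rfl
    rw [show range n = range (a + (t + 1)) by congr 1; omega, sum_range_add]
    have hzero : ∑ u ∈ range a, Z (bpt n M (y - unitVec M e) j + tstep (fine n M) e u, e) = 0 := by
      refine sum_eq_zero fun u hu => ?_
      have hu' : u < a := mem_range.mp hu
      have h3 : t + u < n := by omega
      have h4 : t + u + 1 < n := by omega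
      have hsite : bpt n M (y - unitVec M e) j + tstep (fine n M) e u = bpt n M (y - unitVec M e) (Function.update j e ⟨t + u, h3⟩) := by
        rw [hb0, add_assoc, ← tstep_add]
        exact bpt_update_add_tstep n M _ j e ⟨t + u, h3⟩
      have hS1 : ¬ S (y - unitVec M e) := h.noStack' M e hy
      refine extA_eq_zero n M S A ?_ ?_
      · show ¬ S (blockOf n M _); rwa [hsite, blockOf_bpt]
      · show ¬ S (blockOf n M _)
        rwa [hsite, bpt_add_unitVec_of_lt n M _ _ e (by rw [Function.update_self]; exact h4), blockOf_bpt]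
    rw [hzero, zero_add]
    refine sum_congr rfl fun s _ => ?_
    show Z (bpt n M (y - unitVec M e) j + tstep (fine n M) e (a + s), e) = Z (w + tstep (fine n M) e s, e)
    have has : t + (a + s) = (n - 1) + s := by omega
    rw [hw', hb0, add_assoc, add_assoc, ← tstep_add, ← tstep_add, has]
  -- (3) concatenate
  rw [h1, h2, ell, pathSum, ← hw, show range (n + 1) = range ((t + 1) + (a + 1)) by congr 1; omega, sum_range_add]

/-- hence **`(Q′ℓ)(y) = n·((QZ)(y − e, e) + (QZ)(y, e))`** for `y ∈ S` — the block mean of the mismatch is EXACTLY `n` times the sum of two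
Bałaban averages. [cite: Balaban1984PropagatorsI, (1.18)/(1.20) p.20 (shape)] [folklore] -/
theorem QsOp_ell (h : IsEThin M e S) {y : Tor M} (hy : S y) :
    (QsOp n M *ᵥ fun x => ell n M e (ext (starReg n M S) A) x) y
      = (n : ℂ) * ((QvOp n M *ᵥ ext (starReg n M S) A) (y - unitVec M e, e) + (QvOp n M *ᵥ ext (starReg n M S) A) (y, e)) := by
  have hn : (n : ℂ) ≠ 0 := by exact_mod_cast NeZero.ne n
  rw [QsOp_mulVec, QvOp_mulVec, QvOp_mulVec]
  simp_rw [ell_bpt_eq n M e A h hy]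
  rw [sum_add_distrib]
  field_simp
  ring

omit [NeZero n] hM in
/-- the coefficient bookkeeping `Σ_j ‖m‖² = n^d·‖m‖²` on the digit cube. [folklore] -/
theorem sum_const_cube (c : ℝ) : ∑ _j : Fin d → Fin n, c = (n : ℝ) ^ d * c := by
  rw [sum_const, card_univ, Fintype.card_fun, Fintype.card_fin, Fintype.card_fin, nsmul_eq_mul, Nat.cast_pow]

/-- **THE PER-BLOCK BOUND ON THE MISMATCH** (`y ∈ S`):
`Σ_j ‖ℓ(n·y+j)‖² ≤ (n+1)·Σ_{ν≠e} Σ_j lineCurl ν (n·y+j) + 4·n^{d+2}·(‖(QZ)(y−e,e)‖² + ‖(QZ)(y,e)‖²)` — in-block Poincaré for the fluctuation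
(the mismatch is constant along its line and transversally Lipschitz by one line of curls), the exact mean for the rest. [folklore] -/
theorem sum_block_ell_sq_le (h : IsEThin M e S) {y : Tor M} (hy : S y) :
    ∑ j : Fin d → Fin n, ‖ell n M e (ext (starReg n M S) A) (bpt n M y j)‖ ^ 2
      ≤ ((n : ℝ) + 1) * ∑ ν ∈ univ.filter (fun ν : Fin d => ν ≠ e), ∑ j : Fin d → Fin n, lineCurl n M e (ext (starReg n M S) A) ν (bpt n M y j)
        + 4 * (n : ℝ) ^ (d + 2) * (‖(QvOp n M *ᵥ ext (starReg n M S) A) (y - unitVec M e, e)‖ ^ 2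
            + ‖(QvOp n M *ᵥ ext (starReg n M S) A) (y, e)‖ ^ 2) := by
  set Z := ext (starReg n M S) A with hZ
  set L : Tor (fine n M) → ℂ := fun x => ell n M e Z x with hL
  set m := (QsOp n M *ᵥ L) y with hm
  have hn0 : (0 : ℝ) < n := by exact_mod_cast Nat.pos_of_ne_zero (NeZero.ne n)
  -- split into fluctuation and mean
  have hsplit : ∑ j : Fin d → Fin n, ‖L (bpt n M y j)‖ ^ 2
      ≤ 2 * ∑ j : Fin d → Fin n, ‖L (bpt n M y j) - m‖ ^ 2 + 2 * ((n : ℝ) ^ d * ‖m‖ ^ 2) := by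
    rw [← sum_const_cube n, mul_sum, mul_sum, ← sum_add_distrib]
    refine sum_le_sum fun j _ => ?_
    have e1 : L (bpt n M y j) = (L (bpt n M y j) - m) + m := by ring
    have := norm_add_le (L (bpt n M y j) - m) m
    nlinarith [norm_nonneg (L (bpt n M y j) - m), norm_nonneg m, norm_nonneg (L (bpt n M y j)),
      sq_nonneg (‖L (bpt n M y j) - m‖ - ‖m‖), congrArg (fun w => ‖w‖) e1]
  -- the fluctuation: in-block Poincaré, the `e`-bonds contribute nothing, the `ν`-bonds one line of curls each
  have hP := sum_block_norm_sub_mean_sq_le n M L y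
  have hterm : ∀ ν (j : Fin d → Fin n), (j ν : ℕ) + 1 < n →
      ‖(sdiff (fine n M) (n : ℂ) ν *ᵥ L) (bpt n M y j)‖ ^ 2 ≤ if ν = e then 0 else ((n : ℝ) + 1) * lineCurl n M e Z ν (bpt n M y j) := by
    intro ν j hj
    have hx : blockReg n M S (bpt n M y j) := show S (blockOf n M _) by rw [blockOf_bpt]; exact hy
    rw [sdiff_mulVec]
    by_cases hν : ν = e
    · subst hν
      have hlt : edig n M ν (bpt n M y j) + 1 < n := by rw [edig_bpt]; exact hj
      rw [if_pos rfl, hL]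
      simp only
      rw [ell, ell, pathSum, pathSum, xstart_add_unitVec_e n M ν _ hlt, sub_self, mul_zero, norm_zero, zero_pow two_ne_zero]
    · rw [if_neg hν, hL]
      simp only
      rw [ell_add_unitVec_ne n M e _ hν (anchor_start n M e A h hx hν) (anchor_end n M e A h hx hν), mul_neg, norm_neg, ← mul_assoc,
        mul_inv_cancel₀ (by exact_mod_cast NeZero.ne n : (n : ℂ) ≠ 0), one_mul]
      have := norm_curlSum_sq_le n M e Z ν (bpt n M y j) (k := n + 1) le_rfl
      push_cast at this
      exact this
  have hfluc : ∑ j : Fin d → Fin n, ‖L (bpt n M y j) - m‖ ^ 2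
      ≤ ((n : ℝ) + 1) / 2 * ∑ ν ∈ univ.filter (fun ν : Fin d => ν ≠ e), ∑ j : Fin d → Fin n, lineCurl n M e Z ν (bpt n M y j) := by
    refine hP.trans ?_
    have hcoef : ((n : ℝ) - 1) / (2 * n) ≤ 1 / 2 := by
      rw [div_le_div_iff₀ (by positivity) (by norm_num)]; linarith
    have hinner : ∑ ν : Fin d, ∑ j ∈ univ.filter (fun j : Fin d → Fin n => (j ν : ℕ) + 1 < n), ‖(sdiff (fine n M) (n : ℂ) ν *ᵥ L) (bpt n M y j)‖ ^ 2
        ≤ ((n : ℝ) + 1) * ∑ ν ∈ univ.filter (fun ν : Fin d => ν ≠ e), ∑ j : Fin d → Fin n, lineCurl n M e Z ν (bpt n M y j) := by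
      rw [mul_sum, sum_filter]
      refine sum_le_sum fun ν _ => ?_
      calc ∑ j ∈ univ.filter (fun j : Fin d → Fin n => (j ν : ℕ) + 1 < n), ‖(sdiff (fine n M) (n : ℂ) ν *ᵥ L) (bpt n M y j)‖ ^ 2
          ≤ ∑ j ∈ univ.filter (fun j : Fin d → Fin n => (j ν : ℕ) + 1 < n),
              (if ν = e then 0 else ((n : ℝ) + 1) * lineCurl n M e Z ν (bpt n M y j)) :=
            sum_le_sum fun j hj => hterm ν j (mem_filter.mp hj).2
        _ ≤ ∑ j : Fin d → Fin n, (if ν = e then 0 else ((n : ℝ) + 1) * lineCurl n M e Z ν (bpt n M y j)) :=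
            sum_le_sum_of_subset_of_nonneg (filter_subset _ _) fun j _ _ => by
              split_ifs
              · exact le_rfl
              · exact mul_nonneg (by positivity) (lineCurl_nonneg n M e Z ν _)
        _ = if ν ≠ e then ((n : ℝ) + 1) * ∑ j : Fin d → Fin n, lineCurl n M e Z ν (bpt n M y j) else 0 := by
            by_cases hν : ν = e
            · rw [if_neg (not_not.mpr hν)]; simp [hν]
            · rw [if_pos hν, mul_sum]; simp [hν]
    have hnn : 0 ≤ ∑ ν : Fin d, ∑ j ∈ univ.filter (fun j : Fin d → Fin n => (j ν : ℕ) + 1 < n),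
        ‖(sdiff (fine n M) (n : ℂ) ν *ᵥ L) (bpt n M y j)‖ ^ 2 := sum_nonneg fun _ _ => sum_nonneg fun _ _ => by positivity
    calc ((n : ℝ) - 1) / (2 * n) * _ ≤ 1 / 2 * _ := mul_le_mul_of_nonneg_right hcoef hnn
      _ ≤ 1 / 2 * (((n : ℝ) + 1) * ∑ ν ∈ univ.filter (fun ν : Fin d => ν ≠ e), ∑ j : Fin d → Fin n, lineCurl n M e Z ν (bpt n M y j)) :=
          mul_le_mul_of_nonneg_left hinner (by norm_num)
      _ = _ := by ring
  -- the mean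
  have hmean : (n : ℝ) ^ d * ‖m‖ ^ 2 ≤ 2 * (n : ℝ) ^ (d + 2) * (‖(QvOp n M *ᵥ Z) (y - unitVec M e, e)‖ ^ 2 + ‖(QvOp n M *ᵥ Z) (y, e)‖ ^ 2) := by
    rw [hm, hL, QsOp_ell n M e A h hy, norm_mul, Complex.norm_natCast, mul_pow]
    have := norm_add_le ((QvOp n M *ᵥ Z) (y - unitVec M e, e)) ((QvOp n M *ᵥ Z) (y, e))
    have h2 : ‖(QvOp n M *ᵥ Z) (y - unitVec M e, e) + (QvOp n M *ᵥ Z) (y, e)‖ ^ 2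
        ≤ 2 * (‖(QvOp n M *ᵥ Z) (y - unitVec M e, e)‖ ^ 2 + ‖(QvOp n M *ᵥ Z) (y, e)‖ ^ 2) := by
      nlinarith [norm_nonneg ((QvOp n M *ᵥ Z) (y - unitVec M e, e) + (QvOp n M *ᵥ Z) (y, e)),
        norm_nonneg ((QvOp n M *ᵥ Z) (y - unitVec M e, e)), norm_nonneg ((QvOp n M *ᵥ Z) (y, e)),
        sq_nonneg (‖(QvOp n M *ᵥ Z) (y - unitVec M e, e)‖ - ‖(QvOp n M *ᵥ Z) (y, e)‖)]
    calc (n : ℝ) ^ d * ((n : ℝ) ^ 2 * ‖(QvOp n M *ᵥ Z) (y - unitVec M e, e) + (QvOp n M *ᵥ Z) (y, e)‖ ^ 2)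
        ≤ (n : ℝ) ^ d * ((n : ℝ) ^ 2 * (2 * (‖(QvOp n M *ᵥ Z) (y - unitVec M e, e)‖ ^ 2 + ‖(QvOp n M *ᵥ Z) (y, e)‖ ^ 2))) := by
          gcongr
      _ = _ := by ring
  calc ∑ j : Fin d → Fin n, ‖L (bpt n M y j)‖ ^ 2
      ≤ 2 * ∑ j : Fin d → Fin n, ‖L (bpt n M y j) - m‖ ^ 2 + 2 * ((n : ℝ) ^ d * ‖m‖ ^ 2) := hsplit
    _ ≤ 2 * (((n : ℝ) + 1) / 2 * ∑ ν ∈ univ.filter (fun ν : Fin d => ν ≠ e), ∑ j : Fin d → Fin n, lineCurl n M e Z ν (bpt n M y j))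
        + 2 * (2 * (n : ℝ) ^ (d + 2) * (‖(QvOp n M *ᵥ Z) (y - unitVec M e, e)‖ ^ 2 + ‖(QvOp n M *ᵥ Z) (y, e)‖ ^ 2)) := by
        gcongr
    _ = _ := by ring

end Summit.QuantumFields.BalabanUV.T4Continuum.RegionStarLineGaugeBound

end
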